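import Mathlib.Geometry.Manifold.IntegralCurve.Basic
import Mathlib.Geometry.Manifold.MFDeriv.Tangent
import Mathlib.Geometry.Manifold.MFDeriv.Atlas
import Mathlib.Geometry.Manifold.VectorBundle.Basic
import Mathlib.Analysis.ODE.ExistUnique
import Mathlib.Analysis.Calculus.ContDiff.RCLike
import HarnessLib

/-!
# Integral curves of time-dependent vector fields on manifolds: uniqueness

Topic `Literature/Geometry/Manifold`. Mathlib treats integral curves of *autonomous* vector
fields on manifolds (`IsMIntegralCurveOn γ v s`, `Mathlib/Geometry/Manifold/IntegralCurve/`,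
with local and global uniqueness for `C¹` fields, `isMIntegralCurveAt_eventuallyEq_of_contMDiffAt`,
`isMIntegralCurveOn_Ioo_eqOn_of_contMDiff`), and, in normed spaces, uniqueness for
*time-dependent* Lipschitz fields on closed intervals with one-sided derivatives at the initial
time (`ODE_solution_unique_of_mem_Icc_right`). This file combines the two: **integral curves of a
time-dependent vector field `v t` on a manifold, on a closed time interval `[t₀, t₁]` and with
the same initial point, coincide**, for fields which are `C¹` jointly in space and time
(Lee, *Introduction to Smooth Manifolds*, 2nd ed. (2012), Ch. 9, "Time-Dependent Vector Fields",
Thm. 9.48 (a)–(b), pp. 236–237, uniqueness clause; the flows there are on open sets, the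
one-sided closed-interval form is the one needed for evolution equations posed on `[0, T]`, e.g.
the DeTurck diffeomorphisms of Ricci flow, Andrews–Hopper 2011, §5.4.2, Steps 2 and 6).

## Contents

* `IsTimeDepMIntegralCurveOn γ v s` — `γ : ℝ → M` is an integral curve on the time set `s ⊆ ℝ` of
  the time-dependent vector field `v : ℝ → Π x, T_x M`: `γ'(t) = v t (γ t)` as a derivative
  within `s` (`HasMFDerivWithinAt`), for all `t ∈ s`; for constant `v` this is Mathlib's
  `IsMIntegralCurveOn` (`isTimeDepMIntegralCurveOn_const_iff`).
* `IsTimeDepMIntegralCurveOn.hasDerivWithinAt` — the equation read in an extended chart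
  (the analogue of Mathlib's `IsMIntegralCurveOn.hasDerivWithinAt`).
* `exists_lipschitzOnWith_fieldInChart` — a field which is `C¹` jointly on `M × [t₀, t₁]` (as a
  map into the tangent bundle) is, read in a chart, Lipschitz in space uniformly for nearby times.
* `IsTimeDepMIntegralCurveOn.eqOn_Icc_of_lipschitzOnWith` (local forward uniqueness in a chart,
  by Grönwall: Mathlib's `ODE_solution_unique_of_mem_Icc_right`) and the main theorem
  `IsTimeDepMIntegralCurveOn.eqOn_Icc` — **uniqueness on `[t₀, t₁]`** for jointly `C¹` fields on
  a Hausdorff manifold with boundaryless model, globalised by "real induction"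
  (`IsClosed.Icc_subset_of_forall_exists_gt`).

Everything here is proved; there are no named facts.

## References

* J. M. Lee, *Introduction to Smooth Manifolds*, 2nd ed., GTM 218, Springer 2012, Ch. 9,
  Thm. 9.48 (time-dependent flows), pp. 236–237. [Lee2012]
* B. Andrews, C. Hopper, *The Ricci flow in Riemannian geometry*, LNM 2011 (2011), §5.4.2,
  Steps 2 and 6 (the use made of it for the DeTurck diffeomorphisms). [AndrewsHopper2011]
-/

noncomputable section

open Set Filter Metric Bundle
open scoped Manifold Topology NNReal ContDiff

namespace Literature.Geometry.Manifold

variable {E : Type*} [NormedAddCommGroup E] [NormedSpace ℝ E] {H : Type*} [TopologicalSpace H]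
  {I : ModelWithCorners ℝ E H} {M : Type*} [TopologicalSpace M] [ChartedSpace H M]

/-! ### Time-dependent integral curves -/

/-- `γ : ℝ → M` is an **integral curve, on the time set `s`, of the time-dependent vector field**
`v : ℝ → Π x, T_x M`: for every `t ∈ s`, `γ` has derivative `v t (γ t)` at `t` within `s`
(one-sided at boundary points of `s`, e.g. at the initial time of `s = [t₀, t₁]`). The values of
`γ` outside `s` are irrelevant. For a field constant in time this is Mathlib's
`IsMIntegralCurveOn`. Lee 2012, Ch. 9, pp. 236–237 ("an integral curve of `V` is a curve `γ`
with `γ'(t) = V(t, γ(t))`"). [cite: Lee2012, Ch. 9, pp. 236–237] -/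
def IsTimeDepMIntegralCurveOn (γ : ℝ → M) (v : ℝ → (x : M) → TangentSpace I x) (s : Set ℝ) :
    Prop :=
  ∀ t ∈ s, HasMFDerivWithinAt 𝓘(ℝ, ℝ) I γ s t ((1 : ℝ →L[ℝ] ℝ).smulRight (v t (γ t)))

variable {γ γ' : ℝ → M} {v : ℝ → (x : M) → TangentSpace I x} {s s' : Set ℝ} {t₀ t₁ : ℝ}

/-- For a time-independent field, time-dependent integral curves are Mathlib's integral curves.
[folklore] -/
theorem isTimeDepMIntegralCurveOn_const_iff {w : (x : M) → TangentSpace I x} :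
    IsTimeDepMIntegralCurveOn γ (fun _ ↦ w) s ↔ IsMIntegralCurveOn γ w s :=
  Iff.rfl

namespace IsTimeDepMIntegralCurveOn

/-- Restriction of the time set. [folklore] -/
theorem mono (h : IsTimeDepMIntegralCurveOn γ v s) (hs : s' ⊆ s) :
    IsTimeDepMIntegralCurveOn γ v s' :=
  fun t ht ↦ (h t (hs ht)).mono hs

/-- An integral curve is continuous within its time set. [folklore] -/
theorem continuousWithinAt (h : IsTimeDepMIntegralCurveOn γ v s) {t : ℝ} (ht : t ∈ s) :
    ContinuousWithinAt γ s t :=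
  (h t ht).continuousWithinAt

/-- An integral curve is continuous on its time set. [folklore] -/
theorem continuousOn (h : IsTimeDepMIntegralCurveOn γ v s) : ContinuousOn γ s :=
  fun _ ht ↦ h.continuousWithinAt ht

/-- If the field is changed to one agreeing with it along the curve on `s`, the curve is still an
integral curve. [folklore] -/
theorem congr_field {v' : ℝ → (x : M) → TangentSpace I x} (h : IsTimeDepMIntegralCurveOn γ v s)
    (hv : ∀ t ∈ s, v' t (γ t) = v t (γ t)) : IsTimeDepMIntegralCurveOn γ v' s :=
  fun t ht ↦ by rw [hv t ht]; exact h t ht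

variable [IsManifold I 1 M]

set_option backward.isDefEq.respectTransparency false in
/-- The integral curve equation read in the extended chart at `x₀`: while `γ t` lies in the chart
domain, `(extChartAt I x₀ ∘ γ)' (t) = D(coordinate change)(v t (γ t))` within `s` (the analogue of
Mathlib's `IsMIntegralCurveOn.hasDerivWithinAt`, which is the case `x₀ = γ t₀`). [folklore] -/
theorem hasDerivWithinAt (hγ : IsTimeDepMIntegralCurveOn γ v s) {t : ℝ} (ht : t ∈ s) {x₀ : M}
    (hsrc : γ t ∈ (extChartAt I x₀).source) :
    HasDerivWithinAt ((extChartAt I x₀) ∘ γ)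
      (tangentCoordChange I (γ t) x₀ (γ t) (v t (γ t))) s t := by
  replace hsrc := extChartAt_source I x₀ ▸ hsrc
  rw [hasDerivWithinAt_iff_hasFDerivWithinAt, ← hasMFDerivWithinAt_iff_hasFDerivWithinAt]
  apply (HasMFDerivWithinAt.comp t (hasMFDerivWithinAt_extChartAt (I := I) hsrc) (hγ _ ht)
    (subset_preimage_image _ _)).congr_mfderiv
  rw [ContinuousLinearMap.ext_iff]
  intro a
  rw [ContinuousLinearMap.comp_apply, ContinuousLinearMap.smulRight_apply, map_smul,
    ← one_apply_eq_self (F := TangentSpace 𝓘(ℝ, ℝ) t →L[ℝ] TangentSpace 𝓘(ℝ, ℝ) t) a,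
    ← ContinuousLinearMap.smulRight_apply, mfderiv_chartAt_eq_tangentCoordChange hsrc]
  rfl

end IsTimeDepMIntegralCurveOn

/-! ### Charts of `M × ℝ` -/

/-- Inverse of the extended chart of `M × ℝ` at `(x₀, t)`: it is `(extChartAt I x₀)⁻¹ × id`.
[folklore] -/
theorem extChartAt_prod_real_symm_apply (x₀ : M) (t : ℝ) (q : E × ℝ) :
    (extChartAt (I.prod 𝓘(ℝ, ℝ)) (x₀, t)).symm q = ((extChartAt I x₀).symm q.1, q.2) := by
  rw [extChartAt_prod, PartialEquiv.prod_symm]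
  simp

/-- The extended chart of `M × ℝ` at `(x₀, t)` is `extChartAt I x₀ × id`. [folklore] -/
theorem extChartAt_prod_real_apply (x₀ : M) (t : ℝ) (p : M × ℝ) :
    extChartAt (I.prod 𝓘(ℝ, ℝ)) (x₀, t) p = (extChartAt I x₀ p.1, p.2) := by
  rw [extChartAt_prod]
  simp

/-! ### The field read in a chart; Lipschitz continuity from joint differentiability -/

variable [IsManifold I 1 M]

variable (v) in
/-- The time-dependent field `v` read in the extended chart at `x₀`: the vector field on the model
space `E` whose value at `y` is `v t` at `(extChartAt I x₀)⁻¹ y`, transported by the derivative of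
the chart (Mathlib's `tangentCoordChange`; junk outside the chart target). This is the function
`v'` of Mathlib's proof of `isMIntegralCurveAt_eventuallyEq_of_contMDiffAt`, with time added.
[folklore] -/
def fieldInChart (x₀ : M) (t : ℝ) (y : E) : E :=
  tangentCoordChange I ((extChartAt I x₀).symm y) x₀ ((extChartAt I x₀).symm y)
    (v t ((extChartAt I x₀).symm y))

/-- The second component of the tangent bundle trivialization at `x₀` is the tangent coordinate
change to the chart at `x₀` (definitional; compare `TangentBundle.trivializationAt_apply`).
[folklore] -/
theorem trivializationAt_tangentSpace_snd (x₀ x : M) (w : TangentSpace I x) :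
    (trivializationAt E (TangentSpace I) x₀ (⟨x, w⟩ : TangentBundle I M)).2 =
      tangentCoordChange I x x₀ x w :=
  rfl

/-- **Lipschitz in space, locally uniformly in time.** If the time-dependent field `v`, as the
map `(x, t) ↦ (x, v t x)` from `M × ℝ` to `TM`, is `C¹` within `M × [t₀, t₁]` at `(x₀, t)`,
`t ∈ [t₀, t₁]` (boundaryless model), then read in the chart at `x₀` it is `K`-Lipschitz on a ball
around the image of `x₀`, for all times of `[t₀, t₁]` within `r` of `t`: a `C¹` function on a
convex set is locally Lipschitz (Mathlib's `ContDiffWithinAt.exists_lipschitzOnWith`), applied on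
`E × [t₀, t₁]`. Lee 2012, proof of Thm. 9.48 (reduction to the autonomous case on `ℝ × M`) /
Thm. D.1 (Lipschitz estimate). [folklore] -/
theorem exists_lipschitzOnWith_fieldInChart [I.Boundaryless] {t : ℝ} {x₀ : M}
    (hv : ContMDiffWithinAt (I.prod 𝓘(ℝ, ℝ)) I.tangent 1
      (fun p : M × ℝ ↦ (⟨p.1, v p.2 p.1⟩ : TangentBundle I M)) (univ ×ˢ Icc t₀ t₁) (x₀, t)) :
    ∃ K : ℝ≥0, ∃ r > (0 : ℝ), ∀ t' ∈ Icc t₀ t₁, dist t' t < r →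
      LipschitzOnWith K (fieldInChart v x₀ t') (ball (extChartAt I x₀ x₀) r) := by
  rw [contMDiffWithinAt_totalSpace] at hv
  obtain ⟨-, hv⟩ := hv
  rw [contMDiffWithinAt_iff] at hv
  obtain ⟨-, hv⟩ := hv
  -- the function and the set, read in the charts of `M × ℝ` and `E`
  set G : E × ℝ → E := fun q ↦ fieldInChart v x₀ q.2 q.1 with hG
  have hfun : (extChartAt 𝓘(ℝ, E) ((trivializationAt E (TangentSpace I)
        ((fun p : M × ℝ ↦ (⟨p.1, v p.2 p.1⟩ : TangentBundle I M)) (x₀, t)).proj)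
        ((fun p : M × ℝ ↦ (⟨p.1, v p.2 p.1⟩ : TangentBundle I M)) (x₀, t))).2 ∘
        (fun p : M × ℝ ↦ (trivializationAt E (TangentSpace I)
          ((fun p : M × ℝ ↦ (⟨p.1, v p.2 p.1⟩ : TangentBundle I M)) (x₀, t)).proj
          ((fun p : M × ℝ ↦ (⟨p.1, v p.2 p.1⟩ : TangentBundle I M)) p)).2) ∘
        (extChartAt (I.prod 𝓘(ℝ, ℝ)) (x₀, t)).symm) = G := by
    funext q
    simp only [Function.comp_apply, extChartAt_model_space_eq_id, PartialEquiv.refl_coe, id_eq,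
      extChartAt_prod_real_symm_apply, hG, fieldInChart]
    rfl
  have hset : (extChartAt (I.prod 𝓘(ℝ, ℝ)) (x₀, t)).symm ⁻¹' (univ ×ˢ Icc t₀ t₁) ∩
      range (I.prod 𝓘(ℝ, ℝ)) = (univ : Set E) ×ˢ Icc t₀ t₁ := by
    rw [ModelWithCorners.Boundaryless.range_eq_univ, inter_univ]
    ext q
    simp only [mem_preimage, extChartAt_prod_real_symm_apply, mem_prod, mem_univ, true_and]
  have hpt : extChartAt (I.prod 𝓘(ℝ, ℝ)) (x₀, t) (x₀, t) = (extChartAt I x₀ x₀, t) :=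
    extChartAt_prod_real_apply x₀ t (x₀, t)
  rw [hfun, hset, hpt] at hv
  -- a `C¹` function on the convex set `E × [t₀, t₁]` is locally Lipschitz
  obtain ⟨K, U, hU, hlip⟩ := hv.exists_lipschitzOnWith (convex_univ.prod (convex_Icc t₀ t₁))
  obtain ⟨r, hr, hrU⟩ := Metric.mem_nhdsWithin_iff.1 hU
  refine ⟨K, r, hr, fun t' ht' hdist ↦ ?_⟩
  have hmem : ∀ y ∈ ball (extChartAt I x₀ x₀) r, (y, t') ∈ U := fun y hy ↦
    hrU ⟨by simpa [Prod.dist_eq] using ⟨mem_ball.1 hy, hdist⟩, mem_univ _, ht'⟩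
  intro y hy y' hy'
  have := hlip (hmem y hy) (hmem y' hy')
  simpa [hG, Prod.edist_eq] using this

/-! ### Uniqueness -/

namespace IsTimeDepMIntegralCurveOn

/-- **Local forward uniqueness.** Two integral curves on `[t₀, t₁]` of a time-dependent field
which agree at a time `t ∈ [t₀, t₁)` near which the field, read in the chart at `γ t`, is
Lipschitz in space uniformly in time, agree on some `[t, t + δ]`, `δ > 0`, `t + δ ≤ t₁`: in the
chart both are solutions of the same ODE `y' = F(t', y)` with `F(t', ·)` Lipschitz, one-sided
derivatives at `t`, and the same initial value (Mathlib's `ODE_solution_unique_of_mem_Icc_right`,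
Grönwall). Lee 2012, Thm. 9.48, proof (via Thm. D.1/D.4). [folklore] -/
theorem eqOn_Icc_of_lipschitzOnWith {t : ℝ} (ht : t ∈ Ico t₀ t₁)
    (hγ : IsTimeDepMIntegralCurveOn γ v (Icc t₀ t₁)) (hγ' : IsTimeDepMIntegralCurveOn γ' v (Icc t₀ t₁))
    (h : γ t = γ' t) {K : ℝ≥0} {r : ℝ} (hr : 0 < r)
    (hlip : ∀ t' ∈ Icc t₀ t₁, dist t' t < r →
      LipschitzOnWith K (fieldInChart v (γ t) t') (ball (extChartAt I (γ t) (γ t)) r)) :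
    ∃ δ > (0 : ℝ), t + δ ≤ t₁ ∧ EqOn γ γ' (Icc t (t + δ)) := by
  -- the open set `W` of points of the chart domain at `γ t` mapped into the ball
  have hWo : IsOpen ((extChartAt I (γ t)).source ∩
      extChartAt I (γ t) ⁻¹' ball (extChartAt I (γ t) (γ t)) r) :=
    (continuousOn_extChartAt (γ t)).isOpen_inter_preimage (isOpen_extChartAt_source (γ t))
      isOpen_ball
  -- both curves stay in `W` for a short time after `t`
  have hstay : ∀ {g : ℝ → M}, IsTimeDepMIntegralCurveOn g v (Icc t₀ t₁) → g t = γ t →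
      ∃ δ > (0 : ℝ), ∀ t' ∈ Icc t₀ t₁, dist t' t < δ → g t' ∈ (extChartAt I (γ t)).source ∩
        extChartAt I (γ t) ⁻¹' ball (extChartAt I (γ t) (γ t)) r := by
    intro g hg hgt
    have hcont := hg.continuousWithinAt (Ico_subset_Icc_self ht)
    have hgW : g t ∈ (extChartAt I (γ t)).source ∩
        extChartAt I (γ t) ⁻¹' ball (extChartAt I (γ t) (γ t)) r := by
      rw [hgt]
      exact ⟨mem_extChartAt_source (γ t), by simpa using hr⟩
    obtain ⟨δ, hδ, hδW⟩ := Metric.mem_nhdsWithin_iff.1 (hcont (hWo.mem_nhds hgW))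
    exact ⟨δ, hδ, fun t' ht' hd ↦ hδW ⟨hd, ht'⟩⟩
  obtain ⟨δ₁, hδ₁, hW₁⟩ := hstay hγ rfl
  obtain ⟨δ₂, hδ₂, hW₂⟩ := hstay hγ' h.symm
  -- the common time span
  set δ := min (min δ₁ δ₂) (min r (t₁ - t)) / 2 with hδ
  have hδpos : 0 < δ := by
    have : 0 < t₁ - t := sub_pos.2 ht.2
    positivity
  have hδ₁' : δ < δ₁ := by
    have : min (min δ₁ δ₂) (min r (t₁ - t)) ≤ δ₁ := (min_le_left _ _).trans (min_le_left _ _)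
    linarith
  have hδ₂' : δ < δ₂ := by
    have : min (min δ₁ δ₂) (min r (t₁ - t)) ≤ δ₂ := (min_le_left _ _).trans (min_le_right _ _)
    linarith
  have hδr : δ < r := by
    have : min (min δ₁ δ₂) (min r (t₁ - t)) ≤ r := (min_le_right _ _).trans (min_le_left _ _)
    linarith
  have hδt : t + δ ≤ t₁ := by
    have : min (min δ₁ δ₂) (min r (t₁ - t)) ≤ t₁ - t :=
      (min_le_right _ _).trans (min_le_right _ _)
    linarith
  have hsub : Icc t (t + δ) ⊆ Icc t₀ t₁ := Icc_subset_Icc ht.1 hδt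
  have hdist : ∀ t' ∈ Icc t (t + δ), dist t' t < δ₁ ∧ dist t' t < δ₂ ∧ dist t' t < r := by
    intro t' ht'
    have : dist t' t ≤ δ := by
      rw [Real.dist_eq, abs_of_nonneg (by linarith [ht'.1])]
      linarith [ht'.2]
    exact ⟨by linarith, by linarith, by linarith⟩
  refine ⟨δ, hδpos, hδt, ?_⟩
  -- in the chart, both curves solve the same ODE with Lipschitz right-hand side
  have key : EqOn (extChartAt I (γ t) ∘ γ) (extChartAt I (γ t) ∘ γ') (Icc t (t + δ)) := by
    have hsol : ∀ {g : ℝ → M}, IsTimeDepMIntegralCurveOn g v (Icc t₀ t₁) →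
        (∀ t' ∈ Icc t (t + δ), g t' ∈ (extChartAt I (γ t)).source ∩
          extChartAt I (γ t) ⁻¹' ball (extChartAt I (γ t) (γ t)) r) →
        ContinuousOn (extChartAt I (γ t) ∘ g) (Icc t (t + δ)) ∧
        (∀ t' ∈ Ico t (t + δ), HasDerivWithinAt (extChartAt I (γ t) ∘ g)
          (fieldInChart v (γ t) t' ((extChartAt I (γ t) ∘ g) t')) (Ici t') t') ∧
        ∀ t' ∈ Ico t (t + δ),
          (extChartAt I (γ t) ∘ g) t' ∈ ball (extChartAt I (γ t) (γ t)) r := by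
      intro g hg hgW
      refine ⟨?_, fun t' ht' ↦ ?_, fun t' ht' ↦ (hgW t' (Ico_subset_Icc_self ht')).2⟩
      · exact (continuousOn_extChartAt (γ t)).comp (hg.continuousOn.mono hsub)
          fun t' ht' ↦ (hgW t' ht').1
      · have ht'I : t' ∈ Icc t₀ t₁ := hsub (Ico_subset_Icc_self ht')
        have hsrc : g t' ∈ (extChartAt I (γ t)).source := (hgW t' (Ico_subset_Icc_self ht')).1
        have hd := hg.hasDerivWithinAt ht'I hsrc
        have heq : fieldInChart v (γ t) t' ((extChartAt I (γ t) ∘ g) t') =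
            tangentCoordChange I (g t') (γ t) (g t') (v t' (g t')) := by
          simp only [fieldInChart, Function.comp_apply]
          rw [PartialEquiv.left_inv _ hsrc]
        rw [heq]
        exact hd.mono_of_mem_nhdsWithin (Icc_mem_nhdsGE_of_mem ⟨ht'I.1, ht'.2.trans_le hδt⟩)
    obtain ⟨hcγ, hdγ, hbγ⟩ := hsol hγ fun t' ht' ↦ hW₁ t' (hsub ht') (hdist t' ht').1
    obtain ⟨hcγ', hdγ', hbγ'⟩ := hsol hγ' fun t' ht' ↦ hW₂ t' (hsub ht') (hdist t' ht').2.1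
    refine ODE_solution_unique_of_mem_Icc_right (v := fieldInChart v (γ t))
      (s := fun _ ↦ ball (extChartAt I (γ t) (γ t)) r) (K := K) (fun t' ht' ↦ ?_)
      hcγ hdγ hbγ hcγ' hdγ' hbγ' ?_
    · exact hlip t' (hsub (Ico_subset_Icc_self ht')) (hdist t' (Ico_subset_Icc_self ht')).2.2
    · exact congrArg (extChartAt I (γ t)) h
  -- pull back through the chart
  intro t' ht'
  have h₁ : γ t' ∈ (extChartAt I (γ t)).source := (hW₁ t' (hsub ht') (hdist t' ht').1).1
  have h₂ : γ' t' ∈ (extChartAt I (γ t)).source := (hW₂ t' (hsub ht') (hdist t' ht').2.1).1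
  have := key ht'
  simp only [Function.comp_apply] at this
  rw [← (extChartAt I (γ t)).left_inv h₁, ← (extChartAt I (γ t)).left_inv h₂, this]

/-- **Uniqueness of integral curves of time-dependent vector fields on closed intervals.** On a
Hausdorff manifold with boundaryless model, let `v` be a time-dependent vector field which is
`C¹` jointly in space and time on `M × [t₀, t₁]` (as the map `(x, t) ↦ (x, v t x)` into `TM`,
within `M × [t₀, t₁]`), and let `γ, γ'` be integral curves of `v` on `[t₀, t₁]` (derivatives
within `[t₀, t₁]`, one-sided at `t₀`) with `γ t₀ = γ' t₀`. Then `γ = γ'` on `[t₀, t₁]`. Proof: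
the set of times where the curves agree is closed in `[t₀, t₁]` (continuity, `M` Hausdorff),
contains `t₀`, and is open to the right by `eqOn_Icc_of_lipschitzOnWith` with
`exists_lipschitzOnWith_fieldInChart`; conclude by `IsClosed.Icc_subset_of_forall_exists_gt`.
Lee 2012, Ch. 9, Thm. 9.48 (uniqueness of integral curves of time-dependent fields, via the
autonomous field `∂/∂s ⊕ V` on `ℝ × M` and Thm. 9.12), in the closed-interval, one-sided form of
Mathlib's `ODE_solution_unique_of_mem_Icc_right`. [cite: Lee2012, Ch. 9, Thm. 9.48] -/
theorem eqOn_Icc [I.Boundaryless] [T2Space M]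
    (hv : ContMDiffOn (I.prod 𝓘(ℝ, ℝ)) I.tangent 1
      (fun p : M × ℝ ↦ (⟨p.1, v p.2 p.1⟩ : TangentBundle I M)) (univ ×ˢ Icc t₀ t₁))
    (hγ : IsTimeDepMIntegralCurveOn γ v (Icc t₀ t₁)) (hγ' : IsTimeDepMIntegralCurveOn γ' v (Icc t₀ t₁))
    (h : γ t₀ = γ' t₀) : EqOn γ γ' (Icc t₀ t₁) := by
  let S : Set ℝ := {t | γ t = γ' t}
  -- the coincidence set is closed in `[t₀, t₁]`
  have hclosed : IsClosed (S ∩ Icc t₀ t₁) := by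
    have hc : ContinuousOn (fun t ↦ (γ t, γ' t)) (Icc t₀ t₁) :=
      hγ.continuousOn.prodMk hγ'.continuousOn
    have hS : S ∩ Icc t₀ t₁ = Icc t₀ t₁ ∩ (fun t ↦ (γ t, γ' t)) ⁻¹' diagonal M := by
      ext t
      simp only [S, mem_inter_iff, mem_setOf_eq, mem_preimage, mem_diagonal_iff]
      exact and_comm
    rw [hS]
    exact hc.preimage_isClosed_of_isClosed isClosed_Icc isClosed_diagonal
  refine fun t ht ↦ (hclosed.Icc_subset_of_forall_exists_gt (s := S) h ?_ ht)
  rintro t ⟨hteq, htI⟩ y hy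
  -- restart at `t`: local uniqueness in the chart at `γ t`
  obtain ⟨K, r, hr, hlip⟩ :=
    exists_lipschitzOnWith_fieldInChart (hv (γ t, t) ⟨mem_univ _, Ico_subset_Icc_self htI⟩)
  obtain ⟨δ, hδ, hδt, heq⟩ := eqOn_Icc_of_lipschitzOnWith htI hγ hγ' hteq hr hlip
  refine ⟨min (t + δ) y, ?_, lt_min (by linarith) hy, min_le_right _ _⟩
  exact heq ⟨le_min (by linarith) (le_of_lt hy), min_le_left _ _⟩

end IsTimeDepMIntegralCurveOn

end Literature.Geometry.Manifold

end
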